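import Summits.Parity.BatemanHorn.Theses.RoughValueTransport
import Literature.NumberTheory.LFunctions.PolynomialRootMoebiusRieszMeanConstant
import HarnessLib

/-!
# Route `RoughValueTransport`, crux `RoughValueLaw` (stmt-Parity-11390), line `friable-deep-tail`:
# the constant of the registered stub S2b₁ identified (hand-back target M0)

`--supports` file of the checked skeleton
`Summits/Parity/BatemanHorn/Cruxes/RoughValueLaw/Lines/friable_deep_tail.lean` (v11).  The landed
stub S2b₁ `stub_rieszMeanRootMoebius` (`…RoughValueLawRieszMeanRootMoebius.lean`, p84364) gives,
for a Bateman–Horn system of ONE polynomial `f₀`, only `∃ L` with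
`Σ_{m ≤ D} μ(m)ρ_{f₀}(m)/m · log(D/m) → L`.  Target (M0) of `HANDBACK-friable-deep-tail.md`
(§"What is open") asked for the VALUE of `L`; this file supplies it:
`L = C(f) = batemanHornConst f = ∏_p (1 − 1/p)⁻¹(1 − ρ_{f₀}(p)/p)`
(`Literature.NumberTheory.LFunctions.tendsto_logRieszMean_moebius_rootCount_batemanHornConst_nat`,
PROVED: Landau's `L(h,1)/κ_K` and the Bateman–Horn product are the two evaluations of
`lim_{s→1⁺} L(μρ_{f₀}, s)ζ(s)`).  Consequence for the line's normal form NF2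
(`residual_iff_roughValueLaw`): for `k = 1` the Type-I limit `M` of `typeISmoothLimit_of_parts` is
explicit, `M = θ⁻¹·lim_D R_f(D) = C(f)/θ_{1,u} = 4u·C(f)` at the line's level `x^{θ_{1,u}}`,
`θ_{1,u} = 1/(4u)`, so the `k = 1` case of the open stub `stub_residual` reads
`residualNorm f u → C(f)·u·(ω(u)/deg f₀ − 4)` — its open (parity) content is unchanged.
-/

noncomputable section

open Filter Finset Polynomial
open scoped Topology BigOperators
open Literature.NumberTheory.Sieve

namespace Summit.Parity.BatemanHorn.Cruxes.RoughValueLaw.FriableDeepTail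

/-- **S2b₁ with its constant (M0 of the hand-back of line `friable-deep-tail`).**  For a
Bateman–Horn system `f` of one polynomial,
`Σ_{m ≤ D} μ(m)·#{r < m : m ∣ f₀(r)}/m · log(D/m) → batemanHornConst f` (`D → ∞`): the limit whose
existence is the registered stub `stub_rieszMeanRootMoebius` is the Bateman–Horn constant
`C(f) = ∏_p (1 − 1/p)⁻¹(1 − ρ_{f₀}(p)/p)`.
[cite: BatemanHornMathComp1962, §2 eq. (2)] -/
theorem rieszMeanRootMoebius_tendsto_batemanHornConst :
    ∀ (f : Fin 1 → ℤ[X]), IsBatemanHornSystem f →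
      Tendsto (fun D : ℕ => ∑ m ∈ Icc 1 D,
        (ArithmeticFunction.moebius m : ℝ) *
          ((#((range m).filter (fun r : ℕ => ((m : ℕ) : ℤ) ∣ (f 0).eval (r : ℤ))) : ℕ) : ℝ) /
            (m : ℝ) * Real.log ((D : ℝ) / m)) atTop (𝓝 (batemanHornConst f)) := by
  intro f hf
  have hf0 : f = ![f 0] := by
    funext i
    fin_cases i
    rfl
  have hg : IsBatemanHornSystem ![f 0] := hf0 ▸ hf
  have h := Literature.NumberTheory.LFunctions.tendsto_logRieszMean_moebius_rootCount_batemanHornConst_nat hg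
  rw [show batemanHornConst f = batemanHornConst ![f 0] by rw [← hf0]]
  refine h.congr fun D => Finset.sum_congr rfl fun m _ => ?_
  rw [Literature.NumberTheory.LFunctions.polyRootCountMod_single_eq_card]

/-- The registered stub S2b₁ recovered from the identified constant (sanity link: the `∃ L`
statement of `stub_rieszMeanRootMoebius` with the witness `L = batemanHornConst f`). [folklore] -/
theorem rieszMeanRootMoebius_exists_eq_batemanHornConst :
    ∀ (f : Fin 1 → ℤ[X]), IsBatemanHornSystem f →
      ∃ L : ℝ, L = batemanHornConst f ∧ Tendsto (fun D : ℕ => ∑ m ∈ Icc 1 D,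
        (ArithmeticFunction.moebius m : ℝ) *
          ((#((range m).filter (fun r : ℕ => ((m : ℕ) : ℤ) ∣ (f 0).eval (r : ℤ))) : ℕ) : ℝ) /
            (m : ℝ) * Real.log ((D : ℝ) / m)) atTop (𝓝 L) :=
  fun f hf => ⟨batemanHornConst f, rfl, rieszMeanRootMoebius_tendsto_batemanHornConst f hf⟩

end Summit.Parity.BatemanHorn.Cruxes.RoughValueLaw.FriableDeepTail
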